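import Literature.Analysis.FluidPDE.NSLocalAnalyticityRadiusSliceIdentity
import HarnessLib

/-!
# The duality identity of the localised field against caloric test fields

Analysis/FluidPDE proofs-layer file (theorems only), module L2b of the proof of the named fact
`Literature.Analysis.FluidPDE.bradshawGrujicKukavica2015_local_analyticity_radius`
(Bradshaw–Grujić–Kukavica 2015, Thm. 2.3, §4). For a classical solution `(u, p)` on the open
cylinder `(-δ, R²) × B(x₁, R)`, an admissible cut-off `χ`, the localised objects `v = χu`,
`ũ = 1_{B(x₁,R-2)}u`, `f₀ = (Δχ)u + (u·∇χ)u + p∇χ`, times `-δ < s₀ ≤ t < R²` and a smooth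
compactly supported divergence-free field `φ`, with the caloric test field
`Φ(s) = e^{(t-s)Δ}φ` (`heatTest 1 φ (t - s)`):

  `⟨v(t), φ⟩ = ⟨v(s₀), Φ(s₀)⟩ + ∫_{(s₀,t)} (⟨f₀(s), Φ(s)⟩ + ⟨ũ(s), DΦ(s)(v(s))⟩ + ⟨ũ(s), DΦ(s)(2∇χ)⟩) ds`

(`integral_inner_locVelocity_eq_duality`) — the duality ("very weak", Fabes–Jones–Rivière) form
of the localised system `∂ₜv - Δv + ∇·(v ⊗ ũ) + ∇·(2∇χ ⊗ ũ) + ∇(χp) = f₀`, which identifies `v`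
with its Oseen representation in the next layer. Proof: on every time line,
`d/ds ⟪v(s,x), Φ(s,x)⟫ = ⟪∂ₛv, Φ⟫ - ⟪v, e^{(t-s)Δ}Δφ⟫(s, x)` (backward heat equation
`∂ₛΦ = -ΔΦ`, `hasDerivAt_heatTest_sub`); the fundamental theorem of calculus on `[s₀, t]`, Fubini
over the compact spatial support, and the slice identity of
`NSLocalAnalyticityRadiusSliceIdentity.lean` at each `s` with `Ψ = Φ(s)` (which is `C^∞` and
divergence free, `isDivFree_heatFlow`, with `ΔΦ(s) = e^{(t-s)Δ}Δφ`, `laplacian_heatFlow`).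

## Mathlib / tree search

Tree: `heatTest`, `hasDerivAt_heatTest_sub`, `continuous_uncurry_heatTest_sub`,
`continuous_uncurry_heatFlow`, `contDiff_heatFlow`, `fderiv_heatFlow`, `laplacian_heatFlow`,
`isDivFree_heatFlow` (`MildSolution(Proofs)`); `continuousOn_timeDeriv_of_contDiffOn`
(`ClassicalSuitable`); modules L1, L2a. Mathlib:
`intervalIntegral.integral_eq_sub_of_hasDerivAt_of_le`, `integral_prod`, `integral_prod_symm`,
`Measure.prod_restrict`, `ContinuousOn.aestronglyMeasurable`,
`IsCompact.exists_bound_of_continuousOn`.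

## References

* Z. Bradshaw, Z. Grujić, I. Kukavica, J. Differential Equations 259 (2015), §4.
  [BradshawGrujicKukavica2015]
* E. B. Fabes, B. F. Jones, N. M. Rivière, Arch. Rational Mech. Anal. 45 (1972), Thm. 2.1
  (the duality form with caloric tests). [FabesJonesRiviere1972]
-/

noncomputable section

open MeasureTheory Set Function Filter Metric Real
open _root_.Topology
open scoped ENNReal ContDiff Laplacian InnerProductSpace RealInnerProductSpace

namespace Literature.Analysis.FluidPDE

namespace BGK2015

variable {x₁ : EuclideanSpace ℝ (Fin 3)} {δ R : ℝ}
  {u : ℝ → EuclideanSpace ℝ (Fin 3) → EuclideanSpace ℝ (Fin 3)}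
  {p : ℝ → EuclideanSpace ℝ (Fin 3) → ℝ} {χ : EuclideanSpace ℝ (Fin 3) → ℝ}

/-! ### Fubini for a bounded integrand supported in a compact spatial set -/

/-- **Swapping a time and a space integral.** If `k : ℝ → ℝ³ → ℝ` is jointly continuous on
`S × ℝ³` for an open `S ⊇ [s₀, t]` and `k(s, x) = 0` for `x` off a compact set `K`, then
`∫ (∫_{(s₀,t]} k(s, x) ds) dx = ∫_{(s₀,t]} (∫ k(s, x) dx) ds` (the integrand is bounded on
`[s₀, t] × K` and vanishes off `ℝ × K`, hence integrable on `(s₀, t] × ℝ³`). [folklore] -/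
theorem integral_setIntegral_swap_of_continuousOn {S : Set ℝ} {s₀ t : ℝ}
    (hst : s₀ ≤ t) (hI : Icc s₀ t ⊆ S) {K : Set (EuclideanSpace ℝ (Fin 3))} (hK : IsCompact K)
    {k : ℝ → EuclideanSpace ℝ (Fin 3) → ℝ} (hk : ContinuousOn (uncurry k) (S ×ˢ univ))
    (h0 : ∀ s x, x ∉ K → k s x = 0) :
    ∫ x, (∫ s in Ioc s₀ t, k s x) = ∫ s in Ioc s₀ t, ∫ x, k s x := by
  have _ := hst
  set μ' : Measure (ℝ × EuclideanSpace ℝ (Fin 3)) :=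
    (volume.restrict (Ioc s₀ t)).prod (volume : Measure (EuclideanSpace ℝ (Fin 3))) with hμ'
  have hμ'' : μ' = (volume : Measure (ℝ × EuclideanSpace ℝ (Fin 3))).restrict (Ioc s₀ t ×ˢ univ) := by
    rw [hμ', Measure.volume_eq_prod, ← Measure.prod_restrict, Measure.restrict_univ]
  -- a bound on the compact box
  obtain ⟨M, hM⟩ := (isCompact_Icc.prod hK).exists_bound_of_continuousOn
    (hk.mono (prod_mono hI (subset_univ _)))
  -- measurability and domination on `(s₀, t] × ℝ³`
  have hmeas : AEStronglyMeasurable (uncurry k) μ' := by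
    rw [hμ'']
    exact (hk.mono (prod_mono (Ioc_subset_Icc_self.trans hI) subset_rfl)).aestronglyMeasurable
      (measurableSet_Ioc.prod MeasurableSet.univ)
  set bound : ℝ × EuclideanSpace ℝ (Fin 3) → ℝ :=
    (univ ×ˢ K).indicator (fun _ => M) with hbound
  have hbi : Integrable bound μ' := by
    rw [hbound, integrable_indicator_iff (MeasurableSet.univ.prod hK.measurableSet)]
    refine integrableOn_const ?_
    rw [hμ', Measure.prod_prod, Measure.restrict_apply MeasurableSet.univ, univ_inter]
    exact ENNReal.mul_ne_top measure_Ioc_lt_top.ne hK.measure_lt_top.ne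
  have hdom : ∀ᵐ z ∂μ', ‖uncurry k z‖ ≤ bound z := by
    rw [hμ'', ae_restrict_iff' (measurableSet_Ioc.prod MeasurableSet.univ)]
    refine Eventually.of_forall fun z hz => ?_
    by_cases hx : z.2 ∈ K
    · rw [hbound, indicator_of_mem (show z ∈ univ ×ˢ K from ⟨mem_univ _, hx⟩)]
      exact hM z ⟨Ioc_subset_Icc_self hz.1, hx⟩
    · rw [hbound, indicator_of_notMem (show z ∉ univ ×ˢ K from fun h => hx h.2)]
      simp [uncurry, h0 z.1 z.2 hx]
  have hint : Integrable (uncurry k) μ' := hbi.mono' hmeas hdom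
  have h1 := integral_prod_symm (uncurry k) hint
  have h2 := integral_prod (uncurry k) hint
  simp only [uncurry_apply_pair] at h1 h2
  rw [← h1, h2]

/-! ### Joint continuity of the ingredients -/

/-- The time derivative of the localised velocity is jointly continuous on `(-δ, R²) × ℝ³`.
[folklore] -/
theorem continuousOn_deriv_locVelocity (hsol : IsCylinderSolution x₁ δ R u p)
    (hχ : IsLocCutoff x₁ R χ) :
    ContinuousOn (fun z : ℝ × EuclideanSpace ℝ (Fin 3) =>
      deriv (fun σ => locVelocity χ u σ z.2) z.1) (Ioo (-δ) (R ^ 2) ×ˢ univ) :=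
  continuousOn_timeDeriv_of_contDiffOn isOpen_Ioo
    ((contDiffOn_uncurry_locVelocity hsol hχ).of_le (by norm_cast))

/-- Off the support of the cut-off the time derivative of the localised velocity vanishes.
[folklore] -/
theorem deriv_locVelocity_eq_zero_of_notMem {x : EuclideanSpace ℝ (Fin 3)} (hx : x ∉ tsupport χ)
    (u : ℝ → EuclideanSpace ℝ (Fin 3) → EuclideanSpace ℝ (Fin 3)) (s : ℝ) :
    deriv (fun σ => locVelocity χ u σ x) s = 0 := by
  have : (fun σ => locVelocity χ u σ x) = fun _ => 0 :=
    funext fun σ => locVelocity_eq_zero_of_notMem hx u σ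
  rw [this, deriv_const]

section Caloric

variable {φ : EuclideanSpace ℝ (Fin 3) → EuclideanSpace ℝ (Fin 3)}
  (hφ : FunctionSpaces.IsTestFunctionOn (⊤ : TopologicalSpace.Opens (EuclideanSpace ℝ (Fin 3))) φ)
include hφ

/-- The caloric test field `(s, x) ↦ e^{(t-s)Δ}φ(x)` is jointly continuous. [folklore] -/
theorem continuous_heatTest_sub (t : ℝ) :
    Continuous fun q : ℝ × EuclideanSpace ℝ (Fin 3) => heatTest 1 φ (t - q.1) q.2 := by
  obtain ⟨C, hC⟩ := hφ.contDiff.continuous.bounded_above_of_compact_support hφ.hasCompactSupport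
  exact continuous_uncurry_heatTest_sub hφ.contDiff.continuous hC 1 t

/-- `(s, x) ↦ e^{(t-s)Δ}Δφ(x)` is jointly continuous. [folklore] -/
theorem continuous_heatFlow_laplacian_sub (t : ℝ) :
    Continuous fun q : ℝ × EuclideanSpace ℝ (Fin 3) => heatFlow (Δ φ) (1 * (t - q.1)) q.2 := by
  have hΔφ : Continuous (Δ φ) := continuous_laplacian (hφ.contDiff.of_le (by norm_cast))
  obtain ⟨C, hC⟩ := hΔφ.bounded_above_of_compact_support
    (hasCompactSupport_laplacian hφ.hasCompactSupport)
  have h2 : Continuous fun q : ℝ × EuclideanSpace ℝ (Fin 3) =>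
      ((1 * (t - q.1), q.2) : ℝ × EuclideanSpace ℝ (Fin 3)) :=
    ((continuous_const.mul (continuous_const.sub continuous_fst)).prodMk continuous_snd)
  exact (continuous_uncurry_heatFlow hΔφ hC).comp h2

/-- `(s, x) ↦ D(e^{(t-s)Δ}φ)(x)` is jointly continuous (the derivative falls on the data).
[folklore] -/
theorem continuous_fderiv_heatTest_sub (t : ℝ) :
    Continuous fun q : ℝ × EuclideanSpace ℝ (Fin 3) => fderiv ℝ (heatTest 1 φ (t - q.1)) q.2 := by
  have hφ1 : ContDiff ℝ 1 φ := hφ.contDiff.of_le (by norm_cast)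
  have hDφ : Continuous (fderiv ℝ φ) := hφ1.continuous_fderiv one_ne_zero
  obtain ⟨C, hC⟩ := hDφ.bounded_above_of_compact_support (hφ.hasCompactSupport.fderiv ℝ)
  have h2 : Continuous fun q : ℝ × EuclideanSpace ℝ (Fin 3) =>
      ((1 * (t - q.1), q.2) : ℝ × EuclideanSpace ℝ (Fin 3)) :=
    ((continuous_const.mul (continuous_const.sub continuous_fst)).prodMk continuous_snd)
  refine ((continuous_uncurry_heatFlow hDφ hC).comp h2).congr fun q => ?_
  simp only [comp_apply, uncurry_apply_pair]
  exact (fderiv_heatFlow hφ1 hφ.hasCompactSupport _ q.2).symm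

end Caloric

/-! ### The time lines -/

section Duality

variable (hsol : IsCylinderSolution x₁ δ R u p) (hχ : IsLocCutoff x₁ R χ)
  {φ : EuclideanSpace ℝ (Fin 3) → EuclideanSpace ℝ (Fin 3)}
  (hφ : FunctionSpaces.IsTestFunctionOn (⊤ : TopologicalSpace.Opens (EuclideanSpace ℝ (Fin 3))) φ)
include hsol hχ hφ

/-- **The backward heat equation on a time line**: for `s ∈ (-δ, R²)`, `s < t`, and every `x`,
`d/ds ⟪v(s, x), e^{(t-s)Δ}φ(x)⟫ = ⟪∂ₛv(s, x), e^{(t-s)Δ}φ(x)⟫ - ⟪v(s, x), e^{(t-s)Δ}Δφ(x)⟫`.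
[cite: FabesJonesRiviere1972, §2 (backward heat equation of the caloric test)] -/
theorem hasDerivAt_inner_locVelocity_heatTest {s t : ℝ} (hs : s ∈ Ioo (-δ) (R ^ 2)) (hst : s < t)
    (x : EuclideanSpace ℝ (Fin 3)) :
    HasDerivAt (fun σ => ⟪locVelocity χ u σ x, heatTest 1 φ (t - σ) x⟫)
      (⟪deriv (fun σ => locVelocity χ u σ x) s, heatTest 1 φ (t - s) x⟫ -
        ⟪locVelocity χ u s x, heatFlow (Δ φ) (1 * (t - s)) x⟫) s := by
  have hv' : HasDerivAt (fun σ => locVelocity χ u σ x) (deriv (fun σ => locVelocity χ u σ x) s) s :=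
    (hasDerivAt_locVelocity hsol hχ hs x).differentiableAt.hasDerivAt
  have hΦ' := hasDerivAt_heatTest_sub (hφ.contDiff.of_le (by norm_cast)) hφ.hasCompactSupport
    one_pos hst x
  refine (hv'.inner ℝ hΦ').congr_deriv ?_
  simp only [inner_neg_right, one_smul]
  ring

/-- **The fundamental theorem of calculus on a time line**: for `-δ < s₀ ≤ t < R²` and every
`x`, `⟪v(t,x), φ(x)⟫ - ⟪v(s₀,x), e^{(t-s₀)Δ}φ(x)⟫ = ∫_{(s₀,t]} (⟪∂ₛv, Φ⟫ - ⟪v, e^{(t-s)Δ}Δφ⟫)(s, x) ds`.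
[folklore] -/
theorem inner_locVelocity_sub_eq_setIntegral {s₀ t : ℝ} (hs₀ : -δ < s₀) (hst : s₀ ≤ t)
    (htR : t < R ^ 2) (x : EuclideanSpace ℝ (Fin 3)) :
    ⟪locVelocity χ u t x, φ x⟫ - ⟪locVelocity χ u s₀ x, heatTest 1 φ (t - s₀) x⟫ =
      ∫ s in Ioc s₀ t, (⟪deriv (fun σ => locVelocity χ u σ x) s, heatTest 1 φ (t - s) x⟫ -
        ⟪locVelocity χ u s x, heatFlow (Δ φ) (1 * (t - s)) x⟫) := by
  set S : Set ℝ := Ioo (-δ) (R ^ 2) with hSdef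
  have hIS : Icc s₀ t ⊆ S := fun s hs => ⟨hs₀.trans_le hs.1, hs.2.trans_lt htR⟩
  have hvc : ContinuousOn (uncurry (locVelocity χ u)) (S ×ˢ univ) :=
    (contDiffOn_uncurry_locVelocity hsol hχ).continuousOn
  have hdtc := continuousOn_deriv_locVelocity hsol hχ
  have hΦc := continuous_heatTest_sub hφ t
  have hΔΦc := continuous_heatFlow_laplacian_sub hφ t
  have hline : ContinuousOn (fun s : ℝ => ((s, x) : ℝ × EuclideanSpace ℝ (Fin 3))) (Icc s₀ t) :=
    (continuous_id.prodMk continuous_const).continuousOn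
  have hmaps : MapsTo (fun s : ℝ => ((s, x) : ℝ × EuclideanSpace ℝ (Fin 3))) (Icc s₀ t)
      (S ×ˢ univ) := fun s hs => ⟨hIS hs, mem_univ _⟩
  have hcont : ContinuousOn (fun s => ⟪locVelocity χ u s x, heatTest 1 φ (t - s) x⟫) (Icc s₀ t) :=
    (hvc.comp hline hmaps).inner (hΦc.comp_continuousOn hline)
  have hderiv : ∀ s ∈ Ioo s₀ t, HasDerivAt (fun σ => ⟪locVelocity χ u σ x, heatTest 1 φ (t - σ) x⟫)
      (⟪deriv (fun σ => locVelocity χ u σ x) s, heatTest 1 φ (t - s) x⟫ -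
        ⟪locVelocity χ u s x, heatFlow (Δ φ) (1 * (t - s)) x⟫) s := fun s hs =>
    hasDerivAt_inner_locVelocity_heatTest hsol hχ hφ (hIS (Ioo_subset_Icc_self hs)) hs.2 x
  have hkcont : ContinuousOn (fun s => ⟪deriv (fun σ => locVelocity χ u σ x) s, heatTest 1 φ (t - s) x⟫ -
      ⟪locVelocity χ u s x, heatFlow (Δ φ) (1 * (t - s)) x⟫) (Icc s₀ t) :=
    ((hdtc.comp hline hmaps).inner (hΦc.comp_continuousOn hline)).sub
      ((hvc.comp hline hmaps).inner (hΔΦc.comp_continuousOn hline))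
  have hkint : IntervalIntegrable (fun s =>
      ⟪deriv (fun σ => locVelocity χ u σ x) s, heatTest 1 φ (t - s) x⟫ -
        ⟪locVelocity χ u s x, heatFlow (Δ φ) (1 * (t - s)) x⟫) volume s₀ t := by
    refine ContinuousOn.intervalIntegrable ?_
    rwa [uIcc_of_le hst]
  have hFTC := intervalIntegral.integral_eq_sub_of_hasDerivAt_of_le hst hcont hderiv hkint
  rw [intervalIntegral.integral_of_le hst] at hFTC
  rw [hFTC]
  simp only [sub_self, heatTest_zero_right]

/-- **The slice identity against the caloric test field**: for `s ∈ (-δ, R²)` and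
`div φ = 0`, the spatial integral of the time-line derivative is the right-hand side of the
localised system tested with `Φ(s) = e^{(t-s)Δ}φ`. [cite: BradshawGrujicKukavica2015, §4 (4.2)–(4.3)] -/
theorem integral_timeline_deriv_eq (hdiv : VectorCalculus.IsDivFree φ) {s : ℝ}
    (hs : s ∈ Ioo (-δ) (R ^ 2)) (t : ℝ) :
    ∫ x, (⟪deriv (fun σ => locVelocity χ u σ x) s, heatTest 1 φ (t - s) x⟫ -
        ⟪locVelocity χ u s x, heatFlow (Δ φ) (1 * (t - s)) x⟫) =
      (∫ x, ⟪locForce χ u p s x, heatTest 1 φ (t - s) x⟫) +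
        (∫ x, ⟪locExtension x₁ R u s x,
            fderiv ℝ (heatTest 1 φ (t - s)) x (locVelocity χ u s x)⟫) +
        ∫ x, ⟪locExtension x₁ R u s x,
            fderiv ℝ (heatTest 1 φ (t - s)) x ((2 : ℝ) • gradient χ x)⟫ := by
  have hφ2 : ContDiff ℝ 2 φ := hφ.contDiff.of_le (by norm_cast)
  have hφ1 : ContDiff ℝ 1 φ := hφ.contDiff.of_le (by norm_cast)
  have hφc := hφ.hasCompactSupport
  have hΨ : ContDiff ℝ 2 (heatTest 1 φ (t - s)) := contDiff_heatFlow hφ2 hφc _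
  have hΨdiv : VectorCalculus.IsDivFree (heatTest 1 φ (t - s)) := isDivFree_heatFlow hφ1 hφc hdiv _
  have hslice := integral_inner_deriv_locVelocity_sub hsol hχ hs hΨ hΨdiv
  have hΔ : ∀ x, (Δ (heatTest 1 φ (t - s))) x = heatFlow (Δ φ) (1 * (t - s)) x := fun x =>
    laplacian_heatFlow hφ2 hφc _ x
  have hK := isCompact_closedBall x₁ (R - 3)
  have hdtc := continuousOn_deriv_locVelocity hsol hχ
  have hΦc := continuous_heatTest_sub hφ t
  have hΔΦc := continuous_heatFlow_laplacian_sub hφ t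
  have i1 : Integrable (fun x => ⟪deriv (fun σ => locVelocity χ u σ x) s,
      heatTest 1 φ (t - s) x⟫) := by
    refine integrable_inner_of_hasCompactSupport_left
      (hdtc.comp_continuous (Continuous.prodMk_right s) fun x => ⟨hs, mem_univ _⟩)
      (hΦc.comp (Continuous.prodMk_right s)) ?_
    refine HasCompactSupport.intro hK fun x hx => ?_
    exact deriv_locVelocity_eq_zero_of_notMem (fun h => hx (hχ.tsupport_subset h)) u s
  have i2 : Integrable (fun x => ⟪locVelocity χ u s x, heatFlow (Δ φ) (1 * (t - s)) x⟫) :=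
    integrable_inner_of_hasCompactSupport_left (contDiff_locVelocity hsol hχ hs).continuous
      (hΔΦc.comp (Continuous.prodMk_right s)) (hasCompactSupport_locVelocity hχ)
  rw [integral_sub i1 i2, ← hslice]
  congr 1
  exact integral_congr_ae (Eventually.of_forall fun x => by simp only [hΔ x])

/-- **The duality identity of the localised field.** For `-δ < s₀ ≤ t < R²` and a smooth
compactly supported divergence-free `φ`, with `Φ(s) = e^{(t-s)Δ}φ = heatTest 1 φ (t - s)`:
`⟨v(t), φ⟩ = ⟨v(s₀), Φ(s₀)⟩ + ∫_{(s₀,t)} (⟨f₀(s), Φ(s)⟩ + ⟨ũ(s), DΦ(s)(v(s))⟩ + ⟨ũ(s), DΦ(s)(2∇χ)⟩) ds`.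
[cite: BradshawGrujicKukavica2015, §4 (4.2)–(4.3)] -/
theorem integral_inner_locVelocity_eq_duality (hdiv : VectorCalculus.IsDivFree φ) {s₀ t : ℝ}
    (hs₀ : -δ < s₀) (hst : s₀ ≤ t) (htR : t < R ^ 2) :
    ∫ x, ⟪locVelocity χ u t x, φ x⟫ =
      (∫ x, ⟪locVelocity χ u s₀ x, heatTest 1 φ (t - s₀) x⟫) +
        ∫ s in Ioo s₀ t,
          ((∫ x, ⟪locForce χ u p s x, heatTest 1 φ (t - s) x⟫) +
            (∫ x, ⟪locExtension x₁ R u s x,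
                fderiv ℝ (heatTest 1 φ (t - s)) x (locVelocity χ u s x)⟫) +
            ∫ x, ⟪locExtension x₁ R u s x,
                fderiv ℝ (heatTest 1 φ (t - s)) x ((2 : ℝ) • gradient χ x)⟫) := by
  set S : Set ℝ := Ioo (-δ) (R ^ 2) with hSdef
  have hIS : Icc s₀ t ⊆ S := fun s hs => ⟨hs₀.trans_le hs.1, hs.2.trans_lt htR⟩
  have ht : t ∈ S := hIS (right_mem_Icc.2 hst)
  have hK := isCompact_closedBall x₁ (R - 3)
  -- the time-line integrand is jointly continuous and spatially supported in `B̄(x₁, R - 3)`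
  have hvc : ContinuousOn (uncurry (locVelocity χ u)) (S ×ˢ univ) :=
    (contDiffOn_uncurry_locVelocity hsol hχ).continuousOn
  have hdtc := continuousOn_deriv_locVelocity hsol hχ
  have hΦc := continuous_heatTest_sub hφ t
  have hΔΦc := continuous_heatFlow_laplacian_sub hφ t
  have hkc : ContinuousOn (uncurry fun s x =>
      ⟪deriv (fun σ => locVelocity χ u σ x) s, heatTest 1 φ (t - s) x⟫ -
        ⟪locVelocity χ u s x, heatFlow (Δ φ) (1 * (t - s)) x⟫) (S ×ˢ univ) :=
    (hdtc.inner hΦc.continuousOn).sub (hvc.inner hΔΦc.continuousOn)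
  have hk0 : ∀ s x, x ∉ closedBall x₁ (R - 3) →
      ⟪deriv (fun σ => locVelocity χ u σ x) s, heatTest 1 φ (t - s) x⟫ -
        ⟪locVelocity χ u s x, heatFlow (Δ φ) (1 * (t - s)) x⟫ = 0 := by
    intro s x hx
    have hxs : x ∉ tsupport χ := fun h => hx (hχ.tsupport_subset h)
    rw [deriv_locVelocity_eq_zero_of_notMem hxs, locVelocity_eq_zero_of_notMem hxs,
      inner_zero_left, inner_zero_left, sub_self]
  have hswap := integral_setIntegral_swap_of_continuousOn hst hIS hK hkc hk0
  -- integrate the time-line identity in `x`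
  have hvt_int : Integrable (fun x => ⟪locVelocity χ u t x, φ x⟫) :=
    integrable_inner_of_hasCompactSupport_left (contDiff_locVelocity hsol hχ ht).continuous
      hφ.contDiff.continuous (hasCompactSupport_locVelocity hχ)
  have hv0_int : Integrable (fun x => ⟪locVelocity χ u s₀ x, heatTest 1 φ (t - s₀) x⟫) :=
    integrable_inner_of_hasCompactSupport_left
      (contDiff_locVelocity hsol hχ (hIS (left_mem_Icc.2 hst))).continuous
      (hΦc.comp (Continuous.prodMk_right s₀)) (hasCompactSupport_locVelocity hχ)
  have e1 : (∫ x, ⟪locVelocity χ u t x, φ x⟫) -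
      ∫ x, ⟪locVelocity χ u s₀ x, heatTest 1 φ (t - s₀) x⟫ =
      ∫ s in Ioc s₀ t, ∫ x, (⟪deriv (fun σ => locVelocity χ u σ x) s, heatTest 1 φ (t - s) x⟫ -
        ⟪locVelocity χ u s x, heatFlow (Δ φ) (1 * (t - s)) x⟫) := by
    rw [← integral_sub hvt_int hv0_int, ← hswap]
    exact integral_congr_ae (Eventually.of_forall fun x =>
      inner_locVelocity_sub_eq_setIntegral hsol hχ hφ hs₀ hst htR x)
  -- identify the inner integral through the slice identity, on `(s₀, t)` (a.e. equal to `(s₀, t]`)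
  have e2 := setIntegral_congr_fun measurableSet_Ioo (μ := (volume : Measure ℝ))
    (fun s (hs : s ∈ Ioo s₀ t) =>
      integral_timeline_deriv_eq hsol hχ hφ hdiv (hIS (Ioo_subset_Icc_self hs)) t)
  have e3 : ∫ s in Ioo s₀ t, ∫ x, (⟪deriv (fun σ => locVelocity χ u σ x) s, heatTest 1 φ (t - s) x⟫ -
      ⟪locVelocity χ u s x, heatFlow (Δ φ) (1 * (t - s)) x⟫) =
      ∫ s in Ioc s₀ t, ∫ x, (⟪deriv (fun σ => locVelocity χ u σ x) s, heatTest 1 φ (t - s) x⟫ -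
        ⟪locVelocity χ u s x, heatFlow (Δ φ) (1 * (t - s)) x⟫) :=
    setIntegral_congr_set Ioo_ae_eq_Ioc
  rw [← e2, e3, ← e1]
  ring

end Duality

end BGK2015

end Literature.Analysis.FluidPDE
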